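import Literature.Geometry.Lorentzian.KerrDataSchwarzschildExtrinsic
import Literature.Geometry.Lorentzian.AsymptoticFlatnessTransition
import Literature.Geometry.Lorentzian.AFEndRestrict
import HarnessLib

/-!
# `KerrShieldedDataExist` — the UNBENT shield is inadmissible in every chart (`a = 0`), I: the two readings
# of the invariant ratio `k(v,v)/h(v,v)` and the chart calculus of an end of `E3`

Negative-side lemmas for crux `stmt-FinalStateConjecture-10055` (route SwallowTheDatum; standing disprover, gen 4;
work file `Cruxes/KerrShieldedDataExist/Disproof.lean` §13.3–§13.4). Part 6 (`UnbentEndNotDR.lean`) showed that the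
unbent Kerr–Schild end violates the Dafermos–Rodnianski METRIC rate in its tautological chart; that route is
chart-specific (in the areal-shift chart the unbent metric is DR at order zero, work file §13.3). The chart-FREE
obstruction is the second fundamental form, through the ratio `k_p(v,v)/h_p(v,v)` of the two `(0,2)`-tensors of a
datum on ONE vector — a number attached to `(p, v)`, readable in any chart:

* Kerr–Schild side (`hRep_self`, `kRep_self`, `mul_hRep_le`): on the position vector of the unbent Schwarzschild slice
  (closed forms `Kerr.hRep`, `Kerr.kRep` of `(Kerr.data M 0 r₀).h/.k`, Cook 2000 (55)–(57)),
  `M · h_y(y,y) ≤ ‖y‖² √(1 + 2M/‖y‖) · k_y(y,y)`, i.e. the ratio is `≥ M/(r^{3/2}√(r+2M)) ≥ M/(r+2M)²`;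
* Dafermos–Rodnianski side (`eventually_abs_kCoeff_le`, `exists_radius_DR_bounds`; any end of any `X`): beyond some
  radius of a DR chart, `h_x(v,v) ≤ 2‖v‖²` and `|k_x(v,v)| ≤ (ε/‖x‖²) h_x(v,v)` for every `v`;
* topology of ends (`exists_far_inter_eq_empty`): the far regions of an end structure eventually avoid any compact set;
* the end chart of `X = E3` as honest calculus (`hCoeff_eq_fderiv`, `kCoeff_eq_fderiv`,
  `fderiv_dataChartTotal_comp_chartExt`): `hCoeff/kCoeff` are `D.h/D.k` composed with the Fréchet derivative of the
  extended inverse chart, whose differential is inverted by that of `chartExt`.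

Part II (`UnbentShieldChartFree.lean`) assembles these into the chart-free lemma. Cook, Living Rev. Relativ. 3 (2000)
5, §3.2.2; Bartnik, CPAM 39 (1986), §1; Dafermos–Rodnianski, Clay lecture notes (2013), App. B.2.3.
-/

set_option linter.dupNamespace false

noncomputable section

open Set Filter Topology Function Asymptotics Bornology
open scoped Manifold ContDiff InnerProductSpace
open Literature.Geometry.Lorentzian
open Literature.Geometry.Lorentzian.AFEnd

namespace Summit.FinalStateConjecture.FinalStateConjecture.Theorems.KerrShieldedDataExist.Negative.ChartFree

variable {X : Type*} [TopologicalSpace X] [ChartedSpace E3 X] [IsManifold (𝓡 3) ∞ X]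

/-- **Lemma B (DR side).** In a Dafermos–Rodnianski chart, the second fundamental form is `o(r⁻²)` RELATIVE TO THE
METRIC on every vector: for every `ε > 0`, far out, `|k_x(v, v)| ≤ ε ‖x‖⁻² h_x(v, v)` for all `v`. -/
theorem eventually_abs_kCoeff_le (e : AFEnd X) (D : InitialDataSet (𝓡 3) X) {M : ℝ}
    (hDR : e.IsStronglyAsymptoticallyFlatDR D M) {ε : ℝ} (hε : 0 < ε) :
    ∀ᶠ x in cobounded E3, ∀ v : E3,
      |AFEnd.kCoeff e D x v v| ≤ ε * ‖x‖ ^ (-2 : ℝ) * AFEnd.hCoeff e D x v v := by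
  -- order-zero parts of the DR conditions
  have hh := hDR.1 0 (Nat.zero_le _)
  have hk := hDR.2 0 (Nat.zero_le _)
  simp only [CharP.cast_eq_zero, sub_zero, norm_iteratedFDeriv_zero] at hh hk
  -- (1) h-part tends to 0 in operator norm: o(‖x‖⁻¹) and ‖x‖⁻¹ → 0
  have hh0 : Tendsto (fun x : E3 ↦ ‖AFEnd.hCoeff e D x - (1 + 2 * M / ‖x‖) • (innerSL ℝ : E3 →L[ℝ] E3 →L[ℝ] ℝ)‖)
      (cobounded E3) (𝓝 0) := by
    have h1 : Tendsto (fun x : E3 ↦ ‖x‖ ^ (-(1:ℝ))) (cobounded E3) (𝓝 0) :=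
      (tendsto_rpow_neg_atTop (by norm_num : (0:ℝ) < 1)).comp (tendsto_norm_cobounded_atTop (E := E3))
    have h2 := hh.trans_tendsto h1
    simpa using h2
  -- the coefficient 2M/‖x‖ → 0
  have hM0 : Tendsto (fun x : E3 ↦ 2 * M / ‖x‖) (cobounded E3) (𝓝 0) := by
    have := (tendsto_norm_cobounded_atTop (E := E3)).inv_tendsto_atTop.const_mul (2 * M)
    simpa [div_eq_mul_inv] using this
  -- (2) far out: ‖h − (1+2M/r)δ‖ ≤ 1/4 and |2M/r| ≤ 1/4, hence h(v,v) ≥ ‖v‖²/2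
  have hA : ∀ᶠ x in cobounded E3,
      ‖AFEnd.hCoeff e D x - (1 + 2 * M / ‖x‖) • (innerSL ℝ : E3 →L[ℝ] E3 →L[ℝ] ℝ)‖ ≤ 1 / 4 := by
    have := hh0.eventually (gt_mem_nhds (by norm_num : (0:ℝ) < 1 / 4))
    exact this.mono fun x hx ↦ by simpa using hx.le
  have hB : ∀ᶠ x in cobounded E3, |2 * M / ‖x‖| ≤ 1 / 4 := by
    have := hM0.abs.eventually (gt_mem_nhds (by simp : |(0:ℝ)| < 1 / 4))
    exact this.mono fun x hx ↦ le_of_lt hx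
  -- (3) k-part: ‖k_x‖ ≤ (ε/2) ‖x‖⁻²
  have hC : ∀ᶠ x in cobounded E3, ‖AFEnd.kCoeff e D x‖ ≤ ε / 2 * ‖x‖ ^ (-2 : ℝ) := by
    have := hk.def (by positivity : 0 < ε / 2)
    refine this.mono fun x hx ↦ ?_
    simpa [Real.norm_eq_abs, abs_of_nonneg (Real.rpow_nonneg (norm_nonneg x) _)] using hx
  filter_upwards [hA, hB, hC] with x hxA hxB hxC v
  -- metric lower bound
  set B := AFEnd.hCoeff e D x - (1 + 2 * M / ‖x‖) • (innerSL ℝ : E3 →L[ℝ] E3 →L[ℝ] ℝ) with hBdef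
  have hBv : |B v v| ≤ 1 / 4 * ‖v‖ ^ 2 := by
    calc |B v v| = ‖B v v‖ := (Real.norm_eq_abs _).symm
      _ ≤ ‖B‖ * ‖v‖ * ‖v‖ := B.le_opNorm₂ v v
      _ ≤ 1 / 4 * ‖v‖ * ‖v‖ := by gcongr
      _ = 1 / 4 * ‖v‖ ^ 2 := by ring
  have hI : (innerSL ℝ : E3 →L[ℝ] E3 →L[ℝ] ℝ) v v = ‖v‖ ^ 2 := by
    rw [← real_inner_self_eq_norm_sq v]; rfl
  have hhv : AFEnd.hCoeff e D x v v = B v v + (1 + 2 * M / ‖x‖) * ‖v‖ ^ 2 := by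
    rw [hBdef, sub_apply, sub_apply, smul_apply, smul_apply, hI, smul_eq_mul]
    ring
  have hlow : ‖v‖ ^ 2 / 2 ≤ AFEnd.hCoeff e D x v v := by
    rw [hhv]
    have := abs_le.1 hBv
    have := abs_le.1 hxB
    nlinarith [sq_nonneg ‖v‖]
  -- k upper bound
  have hkv : |AFEnd.kCoeff e D x v v| ≤ ε / 2 * ‖x‖ ^ (-2 : ℝ) * ‖v‖ ^ 2 := by
    calc |AFEnd.kCoeff e D x v v| = ‖AFEnd.kCoeff e D x v v‖ := (Real.norm_eq_abs _).symm
      _ ≤ ‖AFEnd.kCoeff e D x‖ * ‖v‖ * ‖v‖ := (AFEnd.kCoeff e D x).le_opNorm₂ v v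
      _ ≤ ε / 2 * ‖x‖ ^ (-2 : ℝ) * ‖v‖ * ‖v‖ := by gcongr
      _ = ε / 2 * ‖x‖ ^ (-2 : ℝ) * ‖v‖ ^ 2 := by ring
  have hpos : 0 ≤ ε * ‖x‖ ^ (-2 : ℝ) := by positivity
  calc |AFEnd.kCoeff e D x v v| ≤ ε / 2 * ‖x‖ ^ (-2 : ℝ) * ‖v‖ ^ 2 := hkv
    _ = ε * ‖x‖ ^ (-2 : ℝ) * (‖v‖ ^ 2 / 2) := by ring
    _ ≤ ε * ‖x‖ ^ (-2 : ℝ) * AFEnd.hCoeff e D x v v := mul_le_mul_of_nonneg_left hlow hpos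



/-- The unbent slice metric on the position vector: `h_y(y, y) = ‖y‖² (1 + 2M/‖y‖)`. [cite: Cook2000, §3.2.2 (55)] -/
theorem hRep_self (M : ℝ) {y : E3} (hy : y ≠ 0) : Kerr.hRep M y y y = ‖y‖ ^ 2 * (1 + 2 * M / ‖y‖) := by
  have hn : ‖y‖ ≠ 0 := norm_ne_zero_iff.2 hy
  rw [Kerr.hRep_apply, real_inner_self_eq_norm_sq]
  field_simp

/-- The unbent slice second fundamental form on the position vector (closed form `Kerr.kRep` = `(Kerr.data M 0 r₀).k`,
`Kerr.data_k_zero_apply`): `k_y(y, y) = 2M (1 + M/‖y‖)/√(1 + 2M/‖y‖)`. [cite: Cook2000, §3.2.2 (57)] -/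
theorem kRep_self (M : ℝ) {y : E3} (hy : y ≠ 0) :
    Kerr.kRep M y y y = 2 * M * (1 + M / ‖y‖) / √(1 + 2 * M / ‖y‖) := by
  have hn : ‖y‖ ≠ 0 := norm_ne_zero_iff.2 hy
  rw [Kerr.kRep, real_inner_self_eq_norm_sq]
  field_simp
  ring

/-- **Far regions eventually avoid any compact set.** For an end structure `e` of `X` (closed at infinity) and a
compact `K ⊆ X` there is a radius `R'` with `e.far R' ∩ K = ∅`. -/
theorem exists_far_inter_eq_empty {X : Type*} [TopologicalSpace X] [ChartedSpace E3 X] (e : AFEnd X)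
    {K : Set X} (hK : IsCompact K) : ∃ R' : ℝ, e.R < R' ∧ e.far R' ∩ K = ∅ := by
  -- closed neighbourhoods of infinity `F n = Φ({R + n + 1 ≤ ‖x‖})`, decreasing, with empty intersection
  set F : ℕ → Set X := fun n ↦ ((↑) : e.U → X) '' (e.chart ⁻¹' {x | e.R + n + 1 ≤ ‖(x : E3)‖}) with hF
  have hFc : ∀ n, IsClosed (F n) := fun n ↦ e.isClosed_far _ (by have := n.cast_nonneg (α := ℝ); linarith)
  have hanti : ∀ {m n : ℕ}, m ≤ n → F n ⊆ F m := by
    intro m n hmn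
    rintro _ ⟨z, hz, rfl⟩
    refine ⟨z, ?_, rfl⟩
    have hmn' : (m : ℝ) ≤ n := Nat.cast_le.2 hmn
    simp only [mem_preimage, mem_setOf_eq] at hz ⊢
    linarith
  have hFd : Directed (· ⊇ ·) F := fun m n ↦
    ⟨max m n, hanti (le_max_left m n), hanti (le_max_right m n)⟩
  have hFi : K ∩ ⋂ n, F n = ∅ := by
    ext p
    simp only [mem_inter_iff, mem_iInter, mem_empty_iff_false, iff_false, not_and, not_forall]
    intro _
    by_cases hp : p ∈ (e.U : Set X)
    · obtain ⟨n, hn⟩ := exists_nat_gt (‖(e.chart ⟨p, hp⟩ : E3)‖ - e.R - 1)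
      refine ⟨n, ?_⟩
      rintro ⟨z, hz, hzp⟩
      have : z = ⟨p, hp⟩ := Subtype.ext hzp
      subst this
      simp only [mem_preimage, mem_setOf_eq] at hz
      linarith
    · refine ⟨0, ?_⟩
      rintro ⟨z, -, rfl⟩
      exact hp z.2
  obtain ⟨n, hn⟩ := hK.elim_directed_family_closed F hFc hFi hFd
  refine ⟨e.R + n + 1, by have := n.cast_nonneg (α := ℝ); linarith, ?_⟩
  rw [Set.inter_comm, ← Set.subset_empty_iff, ← hn]
  exact Set.inter_subset_inter_right _ (by
    rintro _ ⟨z, hz, rfl⟩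
    refine ⟨z, ?_, rfl⟩
    simp only [mem_preimage, mem_setOf_eq] at hz ⊢
    exact le_of_lt hz)




section EndChart

variable (e : AFEnd E3) (D : InitialDataSet (𝓡 3) E3)

/-- Auxiliary step of the chart-free unbent-shield lemma. [folklore] -/
theorem contDiffAt_dataChartTotal {x : E3} (hx : e.R < ‖x‖) : ContDiffAt ℝ ∞ e.dataChartTotal x :=
  contMDiffAt_iff_contDiffAt.1 (e.contMDiffAt_dataChartTotal hx)

/-- Auxiliary step of the chart-free unbent-shield lemma. [folklore] -/
theorem contDiffAt_chartExt {p : E3} (hp : p ∈ e.U) : ContDiffAt ℝ ∞ e.chartExt p :=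
  contMDiffAt_iff_contDiffAt.1 (e.contMDiffAt_chartExt hp)

/-- Auxiliary step of the chart-free unbent-shield lemma. [folklore] -/
theorem mfderiv_dataChartTotal_eq (x : E3) :
    mfderiv 𝓘(ℝ, E3) (𝓡 3) e.dataChartTotal x = fderiv ℝ e.dataChartTotal x :=
  mfderiv_eq_fderiv

/-- `hCoeff` through the Fréchet derivative of the extended inverse chart (`X = E3`). -/
theorem hCoeff_eq_fderiv {x : E3} (hx : e.R < ‖x‖) (v w : E3) :
    hCoeff e D x v w =
      D.h.inner (e.dataChartTotal x) (fderiv ℝ e.dataChartTotal x v) (fderiv ℝ e.dataChartTotal x w) := by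
  rw [hCoeff_eq_inner_dataChartTotal D hx, mfderiv_dataChartTotal_eq e x]
  rfl

/-- `kCoeff` through the Fréchet derivative of the extended inverse chart (`X = E3`). -/
theorem kCoeff_eq_fderiv {x : E3} (hx : e.R < ‖x‖) (v w : E3) :
    kCoeff e D x v w =
      D.k (e.dataChartTotal x) (fderiv ℝ e.dataChartTotal x v) (fderiv ℝ e.dataChartTotal x w) := by
  rw [kCoeff_of_lt D hx]
  change D.k (e.dataChart ⟨x, hx⟩) (mfderiv (𝓡 3) (𝓡 3) e.dataChart ⟨x, hx⟩ v)
    (mfderiv (𝓡 3) (𝓡 3) e.dataChart ⟨x, hx⟩ w) = _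
  rw [mfderiv_dataChart_eq_total, mfderiv_dataChart_eq_total, mfderiv_dataChartTotal_eq e x]
  have hpt : e.dataChart ⟨x, hx⟩ = e.dataChartTotal x := dataChart_eq_dataChartTotal ⟨x, hx⟩
  rw [hpt]
  rfl

/-- The differentials of the chart and of the inverse chart are mutually inverse (at `p ∈ U`, `x = chartExt p`). -/
theorem fderiv_dataChartTotal_comp_chartExt {p : E3} (hp : p ∈ e.U) (v : E3) :
    fderiv ℝ e.dataChartTotal (e.chartExt p) (fderiv ℝ e.chartExt p v) = v := by
  have hx : e.R < ‖e.chartExt p‖ := lt_norm_chartExt hp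
  have h1 : HasFDerivAt e.chartExt (fderiv ℝ e.chartExt p) p :=
    ((contDiffAt_chartExt e hp).differentiableAt (by simp)).hasFDerivAt
  have h2 : HasFDerivAt e.dataChartTotal (fderiv ℝ e.dataChartTotal (e.chartExt p)) (e.chartExt p) :=
    ((contDiffAt_dataChartTotal e hx).differentiableAt (by simp)).hasFDerivAt
  have hcomp := h2.comp p h1
  -- `dataChartTotal ∘ chartExt = id` near `p` (on the open end `U`)
  have hev : (e.dataChartTotal ∘ e.chartExt) =ᶠ[𝓝 p] id := by
    filter_upwards [e.U.isOpen.mem_nhds hp] with q hq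
    exact dataChartTotal_chartExt hq
  have hid : HasFDerivAt (e.dataChartTotal ∘ e.chartExt) (ContinuousLinearMap.id ℝ E3) p :=
    (hasFDerivAt_id p).congr_of_eventuallyEq hev
  have := hcomp.unique hid
  exact congrArg (fun L : E3 →L[ℝ] E3 ↦ L v) this


end EndChart

/-- DR bounds at order zero, quantified with a radius: beyond some `n₁`, `h_x(v,v) ≤ 2‖v‖²` and
`|k_x(v,v)| ≤ (ε/‖x‖²) h_x(v,v)` for all `v`. -/
theorem exists_radius_DR_bounds (e' : AFEnd X) (D' : InitialDataSet (𝓡 3) X) {M' : ℝ}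
    (hDR : e'.IsStronglyAsymptoticallyFlatDR D' M') {ε : ℝ} (hε : 0 < ε) :
    ∃ n₁ : ℝ, ∀ x : E3, n₁ ≤ ‖x‖ → ∀ v : E3,
      AFEnd.hCoeff e' D' x v v ≤ 2 * ‖v‖ ^ 2 ∧
        |AFEnd.kCoeff e' D' x v v| ≤ ε / ‖x‖ ^ 2 * AFEnd.hCoeff e' D' x v v := by
  have hh := hDR.1 0 (Nat.zero_le _)
  simp only [CharP.cast_eq_zero, sub_zero, norm_iteratedFDeriv_zero] at hh
  have hh0 : Tendsto (fun x : E3 ↦ ‖AFEnd.hCoeff e' D' x - (1 + 2 * M' / ‖x‖) • (innerSL ℝ : E3 →L[ℝ] E3 →L[ℝ] ℝ)‖)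
      (cobounded E3) (𝓝 0) := by
    have h1 : Tendsto (fun x : E3 ↦ ‖x‖ ^ (-(1:ℝ))) (cobounded E3) (𝓝 0) :=
      (tendsto_rpow_neg_atTop (by norm_num : (0:ℝ) < 1)).comp (tendsto_norm_cobounded_atTop (E := E3))
    have h2 := hh.trans_tendsto h1
    simpa using h2
  have hM0 : Tendsto (fun x : E3 ↦ 2 * M' / ‖x‖) (cobounded E3) (𝓝 0) := by
    have := (tendsto_norm_cobounded_atTop (E := E3)).inv_tendsto_atTop.const_mul (2 * M')
    simpa [div_eq_mul_inv] using this
  have hA : ∀ᶠ x in cobounded E3,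
      ‖AFEnd.hCoeff e' D' x - (1 + 2 * M' / ‖x‖) • (innerSL ℝ : E3 →L[ℝ] E3 →L[ℝ] ℝ)‖ ≤ 1 / 4 := by
    have := hh0.eventually (gt_mem_nhds (by norm_num : (0:ℝ) < 1 / 4))
    exact this.mono fun x hx ↦ by simpa using hx.le
  have hB : ∀ᶠ x in cobounded E3, |2 * M' / ‖x‖| ≤ 1 / 4 := by
    have := hM0.abs.eventually (gt_mem_nhds (by simp : |(0:ℝ)| < 1 / 4))
    exact this.mono fun x hx ↦ le_of_lt hx
  have hK := eventually_abs_kCoeff_le e' D' hDR hε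
  have hpos : ∀ᶠ x in cobounded E3, (1:ℝ) ≤ ‖x‖ := eventually_cobounded_le_norm 1
  obtain ⟨n₁, -, hn₁⟩ := (Filter.hasBasis_cobounded_norm.eventually_iff).1 (hA.and (hB.and (hK.and hpos)))
  refine ⟨n₁, fun x hx v ↦ ?_⟩
  obtain ⟨hxA, hxB, hxK, hx1⟩ := hn₁ hx
  set B := AFEnd.hCoeff e' D' x - (1 + 2 * M' / ‖x‖) • (innerSL ℝ : E3 →L[ℝ] E3 →L[ℝ] ℝ) with hBdef
  have hBv : |B v v| ≤ 1 / 4 * ‖v‖ ^ 2 := by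
    calc |B v v| = ‖B v v‖ := (Real.norm_eq_abs _).symm
      _ ≤ ‖B‖ * ‖v‖ * ‖v‖ := B.le_opNorm₂ v v
      _ ≤ 1 / 4 * ‖v‖ * ‖v‖ := by gcongr
      _ = 1 / 4 * ‖v‖ ^ 2 := by ring
  have hI : (innerSL ℝ : E3 →L[ℝ] E3 →L[ℝ] ℝ) v v = ‖v‖ ^ 2 := by
    rw [← real_inner_self_eq_norm_sq v]; rfl
  have hhv : AFEnd.hCoeff e' D' x v v = B v v + (1 + 2 * M' / ‖x‖) * ‖v‖ ^ 2 := by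
    rw [hBdef, sub_apply, sub_apply, smul_apply, smul_apply, hI, smul_eq_mul]
    ring
  refine ⟨?_, ?_⟩
  · rw [hhv]
    have := abs_le.1 hBv
    have := abs_le.1 hxB
    nlinarith [sq_nonneg ‖v‖]
  · have hrpow : ‖x‖ ^ (-2 : ℝ) = 1 / ‖x‖ ^ 2 := by
      rw [Real.rpow_neg (norm_nonneg x), one_div]
      norm_num
    have := hxK v
    rw [hrpow] at this
    rw [show ε / ‖x‖ ^ 2 = ε * (1 / ‖x‖ ^ 2) by ring]
    exact this

/-- `h_KS` dominates `δ`: `‖v‖² ≤ hRep M y v v` for `M ≥ 0`. -/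
theorem sq_norm_le_hRep {M : ℝ} (hM : 0 ≤ M) (y v : E3) : ‖v‖ ^ 2 ≤ Kerr.hRep M y v v := by
  rw [Kerr.hRep_apply, real_inner_self_eq_norm_sq]
  have : 0 ≤ 2 * M / ‖y‖ ^ 3 * (⟪y, v⟫_ℝ * ⟪y, v⟫_ℝ) :=
    mul_nonneg (by positivity) (mul_self_nonneg _)
  linarith

/-- Division-free form of Lemma A′: `M · h_y(y,y) ≤ ‖y‖² √(1 + 2M/‖y‖) · k_y(y,y)` for `y ≠ 0`. -/
theorem mul_hRep_le {M : ℝ} (hM : 0 < M) {y : E3} (hy : y ≠ 0) :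
    M * Kerr.hRep M y y y ≤ ‖y‖ ^ 2 * √(1 + 2 * M / ‖y‖) * Kerr.kRep M y y y := by
  have hn : 0 < ‖y‖ := norm_pos_iff.2 hy
  rw [kRep_self M hy, hRep_self M hy]
  set r := ‖y‖ with hr
  have hu : 0 < 1 + 2 * M / r := by positivity
  set S := √(1 + 2 * M / r) with hSdef
  have hS : 0 < S := Real.sqrt_pos.2 hu
  have hS2 : S ^ 2 = 1 + 2 * M / r := Real.sq_sqrt hu.le
  have hr0 : r ≠ 0 := hn.ne'
  have hL : M * (r ^ 2 * (1 + 2 * M / r)) = M * r ^ 2 + 2 * M ^ 2 * r := by field_simp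
  have hR : r ^ 2 * S * (2 * M * (1 + M / r) / S) = 2 * M * r ^ 2 + 2 * M ^ 2 * r := by field_simp
  rw [hL, hR]
  nlinarith [sq_nonneg r]

/-- `r² √(1 + 2M/r) ≤ (r + 2M)²` for `r > 0`, `M ≥ 0`. -/
theorem sq_mul_sqrt_le {M r : ℝ} (hM : 0 ≤ M) (hr : 0 < r) : r ^ 2 * √(1 + 2 * M / r) ≤ (r + 2 * M) ^ 2 := by
  have hu : 0 ≤ 1 + 2 * M / r := by positivity
  have hS := Real.sqrt_nonneg (1 + 2 * M / r)
  have hS2 : √(1 + 2 * M / r) ^ 2 = 1 + 2 * M / r := Real.sq_sqrt hu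
  -- square both sides
  have hlhs : 0 ≤ r ^ 2 * √(1 + 2 * M / r) := by positivity
  have hrhs : 0 ≤ (r + 2 * M) ^ 2 := by positivity
  rw [← abs_of_nonneg hlhs, ← abs_of_nonneg hrhs, ← sq_le_sq]
  have hr0 : r ≠ 0 := hr.ne'
  have : (r ^ 2 * √(1 + 2 * M / r)) ^ 2 = r ^ 3 * (r + 2 * M) := by
    rw [mul_pow, hS2]; field_simp
  rw [this]
  have h1 : r ≤ r + 2 * M := by linarith
  have h3 : r ^ 3 ≤ (r + 2 * M) ^ 3 := by gcongr
  nlinarith [h3, pow_pos (by linarith : 0 < r + 2 * M) 3]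

/-- Points of the inverse chart beyond radius `R'` lie in `far R'`. -/
theorem dataChartTotal_mem_far (e' : AFEnd E3) {R' : ℝ} {x : E3} (hx : e'.R < ‖x‖) (hR' : R' < ‖x‖) :
    e'.dataChartTotal x ∈ e'.far R' := by
  rw [dataChartTotal_of_lt hx]
  exact (e'.dataChart_mem_far_iff).2 hR'


end Summit.FinalStateConjecture.FinalStateConjecture.Theorems.KerrShieldedDataExist.Negative.ChartFree

end
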